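import Summits.AnomalousDissipation.AnomalousDissipation.Theorems.SolenoidalFractalHomogenisationLagrangianStepSidebandXEffGenCoercive
import Summits.AnomalousDissipation.AnomalousDissipation.Theorems.SolenoidalFractalHomogenisationLagrangianStepSidebandXEffGenPsiStar
import Summits.AnomalousDissipation.AnomalousDissipation.Theorems.SolenoidalFractalHomogenisationLagrangianStepSidebandXEffGen
import Summits.AnomalousDissipation.AnomalousDissipation.Theorems.SolenoidalFractalHomogenisationLagrangianStepSidebandXPsiStarLower
import Summits.AnomalousDissipation.AnomalousDissipation.Theorems.SolenoidalFractalHomogenisationLagrangianStepSidebandXGainFormLower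
import Summits.AnomalousDissipation.AnomalousDissipation.Theorems.SolenoidalFractalHomogenisationLagrangianStepSidebandXSlowAveraging
import HarnessLib

/-!
# K1L_D `LagrangianRenormalisationStepDesign` (stmt-AnomalousDissipation-27980), `stub_D1_V0R` (ruling D27-1), brick T8d-(a): THE CONCRETE
# EFFECTIVE GENERATOR `Ḡ = effGenC ((1/n²)•(ν•S + (1/ν)•Ψ⋆_ν(S))) ℓ r₁` — transversal action, norm, and coercivity with rate `4π²·lo_eff·|ℓ|²`
# (helper; `--kind proof --supports stmt-AnomalousDissipation-27980 --as helper`)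

Summits-side helper file of route `SolenoidalFractalHomogenisation` (prover seat `ad-k1l-cellLawV-w1` g7; 0 sorry, no defs, no named facts).
The three hypotheses `hGx`, `hGn`, `hcoer` of `…SidebandXMaster.norm_modeRep_sub_exp_le_master` for the concrete generator of the effective
problem of the clause (`ν•S = 𝔸`, `S = (1/ν)•𝔸`; for the width-B₁ family `(c/ν)•ΨB₁ a ν S = (1/ν)•psiStar W₀ MB MB_pos ν S` at `c = 1/a`):
* **`effGenC_effTensor_apply_of_transversal`** (`hGx`) — on transversal `v`: `Ḡ v = 4π²P_ℓT_{((1/n²)(ν•S))ᵀ}(ℓ)v + slowMean W₁ n ℓ (ν•S) (R0 ν) v`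
  (`…EffGenPsiStar.modalAdjGen_effTensor_apply`), `W₁ = (W.stretch M hM).stretch (1/ν)`;
* **`norm_effGenC_effTensor_le`** (`hGn`) — `‖Ḡ‖ ≤ 4π²((hi'+β'/2)/n²)|ℓ|² + ξ²·Cf·CN + 2|r₁|` (no information on `Ψ⋆` beyond the identification);
* **`effGenC_effTensor_coercive`** (`hcoer`, cubature word, width `B₁`) — under the D27-1 residue hypothesis and the guarded window:
  `4π²·lo_eff·|ℓ|²·‖v‖² ≤ ⟪Ḡ v, v⟫_ℝ`, `lo_eff = (1/n²)(ν·lo/λ + cψ/ν)`, `cψ = (1−ρB)·(97/100)·((3/10)c₀)/(11/10)` (`…EffGenCoercive`, `…PsiStarLower`,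
  `…GainFormLower`).
NOT a proof of any registered stub, of K1L_D, or of anomalous dissipation; rung F-D1.A0 infrastructure.
-/

set_option linter.dupNamespace false

noncomputable section

namespace Summit.AnomalousDissipation.AnomalousDissipation.Theorems.SolenoidalFractalHomogenisation.LagrangianStep.Sideband

open Set
open scoped InnerProductSpace
open Literature.Analysis Literature.Analysis.FunctionSpaces Literature.Analysis.FunctionSpaces.Torus
open Literature.Analysis.FluidPDE Literature.Analysis.FluidPDE.Torus Literature.Analysis.FluidPDE.LatticeShear
open Summit.AnomalousDissipation.AnomalousDissipation.Theorems
open Summit.AnomalousDissipation.AnomalousDissipation.Theorems.SolenoidalFractalHomogenisation.LagrangianStep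
open Summit.AnomalousDissipation.AnomalousDissipation.Theorems.SolenoidalFractalHomogenisation.LagrangianStep.OddGain
open Summit.AnomalousDissipation.AnomalousDissipation.Theorems.SolenoidalFractalHomogenisation.LagrangianStep.WCrossing

variable {k₀ : ℕ}

/-! ## §1 The transversal action (`hGx`) -/

/-- **`hGx`**: on transversal vectors the concrete generator acts as `4π²P_ℓT_{((1/n²)(ν•S))ᵀ}(ℓ) + slowMean`.
[cite: MajdaKramer1999, §2.2.1.3 (55)] -/
theorem effGenC_effTensor_apply_of_transversal (W : LatticeWord k₀) (M : ℝ) (hM : 0 < M) {ν : ℝ} (hν : 0 < ν) {S : Torus.Visc4 (Fin 3)}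
    {lo' hi' : ℝ} (hS : Torus.NearIso (ν • S) lo' hi') (hlo' : 0 < lo') {n : ℕ} (hn : n ≠ 0) (ℓ : Fin 3 → ℤ) (r₁ : ℝ)
    {v : EuclideanSpace ℂ (Fin 3)} (hv : transversalProj ℓ v = v) :
    effGenC ((1 / (n : ℝ) ^ 2) • (ν • S + (1 / ν) • psiStar W M hM ν S)) ℓ r₁ v =
      (((4 * Real.pi ^ 2 : ℝ) : ℂ)) • transversalProj ℓ (Torus.symbT (Torus.majorTranspose ((1 / (n : ℝ) ^ 2) • (ν • S))) ℓ v) +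
        slowMean ((W.stretch M hM).stretch (1 / ν) (one_div_pos.mpr hν)) n ℓ (ν • S) (R0 ν) v := by
  rw [effGenC_apply_of_transversal _ _ _ hv, modalAdjGen_effTensor_apply W M hM hν hS hlo' hn ℓ v, Torus.modalAdjGen_apply]

/-! ## §2 The norm (`hGn`) -/

/-- **`hGn`**: `‖Ḡ‖ ≤ 4π²((hi'+β'/2)/n²)|ℓ|² + ξ²·(Σ4π‖αⱼ‖)(Σ8π‖αⱼ‖/min 1 (4π²lo')) + 2|r₁|` (`NearIso (ν•S) lo' hi'`, `OddSmall (ν•S) β'`).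
[cite: MajdaKramer1999, §2.2.1.3 (55)] -/
theorem norm_effGenC_effTensor_le (W : LatticeWord k₀) (M : ℝ) (hM : 0 < M) {ν : ℝ} (hν : 0 < ν) {S : Torus.Visc4 (Fin 3)}
    {lo' hi' β' : ℝ} (hS : Torus.NearIso (ν • S) lo' hi') (hlo' : 0 < lo') (hhi' : 0 ≤ hi') (hO : Torus.OddSmall (ν • S) β') (hβ' : 0 ≤ β')
    {n : ℕ} (hn : n ≠ 0) (ℓ : Fin 3 → ℤ) (r₁ : ℝ) :
    ‖effGenC ((1 / (n : ℝ) ^ 2) • (ν • S + (1 / ν) • psiStar W M hM ν S)) ℓ r₁‖ ≤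
      4 * Real.pi ^ 2 * (1 / (n : ℝ) ^ 2 * hi' + 1 / (n : ℝ) ^ 2 * β' / 2) * freqNormSq ℓ +
        (Real.sqrt (freqNormSq ℓ) / n) ^ 2 * (∑ j, 4 * Real.pi * ‖slotAmp ((W.stretch M hM).stretch (1 / ν) (one_div_pos.mpr hν)) j‖) *
          (∑ j, 8 * Real.pi * ‖slotAmp ((W.stretch M hM).stretch (1 / ν) (one_div_pos.mpr hν)) j‖ / min 1 (4 * Real.pi ^ 2 * lo')) +
        2 * |r₁| := by
  set W₁ := (W.stretch M hM).stretch (1 / ν) (one_div_pos.mpr hν) with hW₁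
  have hn0 : (0 : ℝ) < n := by exact_mod_cast Nat.pos_of_ne_zero hn
  have hc : (0 : ℝ) ≤ 1 / (n : ℝ) ^ 2 := by positivity
  have hS' : Torus.NearIso ((1 / (n : ℝ) ^ 2) • (ν • S)) (1 / (n : ℝ) ^ 2 * lo') (1 / (n : ℝ) ^ 2 * hi') := hS.smul hc
  have hO' : Torus.OddSmall ((1 / (n : ℝ) ^ 2) • (ν • S)) (1 / (n : ℝ) ^ 2 * β') := hO.smul _
  have hT : Torus.NearIso (Torus.majorTranspose ((1 / (n : ℝ) ^ 2) • (ν • S))) (1 / (n : ℝ) ^ 2 * lo') (1 / (n : ℝ) ^ 2 * hi') :=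
    (Torus.nearIso_majorTranspose_iff _ _ _).2 hS'
  have hOT : Torus.OddSmall (Torus.majorTranspose ((1 / (n : ℝ) ^ 2) • (ν • S))) (1 / (n : ℝ) ^ 2 * β') := hO'.majorTranspose
  have hSM := norm_slowMean_le W₁ n ℓ hS hlo' (R0 ν)
  have hC : 0 ≤ 4 * Real.pi ^ 2 * (1 / (n : ℝ) ^ 2 * hi' + 1 / (n : ℝ) ^ 2 * β' / 2) * freqNormSq ℓ +
      (Real.sqrt (freqNormSq ℓ) / n) ^ 2 * (∑ j, 4 * Real.pi * ‖slotAmp W₁ j‖) *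
        (∑ j, 8 * Real.pi * ‖slotAmp W₁ j‖ / min 1 (4 * Real.pi ^ 2 * lo')) + 2 * |r₁| := by
    have := freqNormSq_nonneg ℓ
    have h1 : 0 ≤ ∑ j, 4 * Real.pi * ‖slotAmp W₁ j‖ := Finset.sum_nonneg fun j _ => by positivity
    have h2 : 0 ≤ ∑ j, 8 * Real.pi * ‖slotAmp W₁ j‖ / min 1 (4 * Real.pi ^ 2 * lo') := Finset.sum_nonneg fun j _ => by positivity
    positivity
  refine ContinuousLinearMap.opNorm_le_bound _ hC fun v => ?_
  have hw : kdot ℓ (transversalProj ℓ v) = 0 := CellChain.kdot_transversalProj' ℓ v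
  rw [effGenC_apply, modalAdjGen_effTensor_apply W M hM hν hS hlo' hn ℓ (transversalProj ℓ v), ← hW₁]
  have h1 := ThreeMode.norm_modalAdjGen_le hT (by positivity) (by positivity) hOT (by positivity) ℓ (transversalProj ℓ v) hw
  have hPv := CellChain.norm_transversalProj_le ℓ v
  have h1' : ‖Torus.modalAdjGen (Torus.majorTranspose ((1 / (n : ℝ) ^ 2) • (ν • S))) ℓ (transversalProj ℓ v)‖ ≤
      4 * Real.pi ^ 2 * (1 / (n : ℝ) ^ 2 * hi' + 1 / (n : ℝ) ^ 2 * β' / 2) * freqNormSq ℓ * ‖v‖ := by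
    refine h1.trans (mul_le_mul_of_nonneg_left hPv ?_)
    have := freqNormSq_nonneg ℓ; positivity
  have h2 : ‖slowMean W₁ n ℓ (ν • S) (R0 ν) (transversalProj ℓ v)‖ ≤
      (Real.sqrt (freqNormSq ℓ) / n) ^ 2 * (∑ j, 4 * Real.pi * ‖slotAmp W₁ j‖) *
        (∑ j, 8 * Real.pi * ‖slotAmp W₁ j‖ / min 1 (4 * Real.pi ^ 2 * lo')) * ‖v‖ :=
    (ContinuousLinearMap.le_opNorm _ _).trans (mul_le_mul hSM hPv (norm_nonneg _)
      ((norm_nonneg _).trans hSM))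
  have h3 : ‖r₁ • (v - transversalProj ℓ v)‖ ≤ 2 * |r₁| * ‖v‖ := by
    rw [norm_smul, Real.norm_eq_abs]
    have : ‖v - transversalProj ℓ v‖ ≤ 2 * ‖v‖ := (norm_sub_le _ _).trans (by linarith)
    nlinarith [abs_nonneg r₁]
  calc _ ≤ ‖Torus.modalAdjGen (Torus.majorTranspose ((1 / (n : ℝ) ^ 2) • (ν • S))) ℓ (transversalProj ℓ v) +
        slowMean W₁ n ℓ (ν • S) (R0 ν) (transversalProj ℓ v)‖ + ‖r₁ • (v - transversalProj ℓ v)‖ := norm_add_le _ _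
    _ ≤ ‖Torus.modalAdjGen (Torus.majorTranspose ((1 / (n : ℝ) ^ 2) • (ν • S))) ℓ (transversalProj ℓ v)‖ +
        ‖slowMean W₁ n ℓ (ν • S) (R0 ν) (transversalProj ℓ v)‖ + ‖r₁ • (v - transversalProj ℓ v)‖ :=
        by
          have hna := norm_add_le (Torus.modalAdjGen (Torus.majorTranspose ((1 / (n : ℝ) ^ 2) • (ν • S))) ℓ (transversalProj ℓ v))
            (slowMean W₁ n ℓ (ν • S) (R0 ν) (transversalProj ℓ v))
          linarith
    _ ≤ _ := by linarith

/-! ## §3 Coercivity for the cubature word (`hcoer`) -/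

/-- **The transverse lower bound of `Ψ⋆` for the cubature word at width `B₁`** from the D27-1 residue hypothesis and the guarded window:
`cψ·|k|²|p|² ≤ symb (psiStar W₀ MB MB_pos ν S) k p` for `p ⊥ k`, `cψ = (1−ρB)(97/100)((3/10)c₀)/(11/10)`.
[cite: MajdaKramer1999, §2.2.1.3 (55)] -/
theorem symb_psiStar_ge_cψ {a : ℝ} (ha : 0 < a)
    (hres : ∀ ν ∈ Set.Ioc 0 νB₁, ∀ S : T4, Torus.NearIso S (10 / 11) (11 / 10) → ∀ τ ∈ Set.Icc (0:ℝ) (1 / 20), OddSectorial S τ →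
      RelSmall (ΨB₁ a ν S - ΦB a S) (ΦB a S) ρB)
    {lo hi ΛV β lam : ℝ} (hlo : 0 < lo) (hlh : lo ≤ hi) (h1 : hi * ΛV ≤ 11 / 10) (h2 : 10 / 11 * ΛV ≤ lo) (hβ0 : 0 ≤ β)
    (hβ : β * ΛV ≤ lo / 20) (hlam : lam ∈ Set.Icc 1 ΛV) {S : T4} (hN : Torus.NearIso S (lo / lam) (hi * lam)) (hO : Torus.OddSmall S β)
    {ν : ℝ} (hν : ν ∈ Set.Ioc 0 νB₁) (k p : Fin 3 → ℝ) (hkp : ∑ i, p i * k i = 0) :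
    (1 - ρB) * (97 / 100) * (3 / 10 * c0) / (11 / 10) * ((∑ a, k a ^ 2) * (∑ i, p i ^ 2)) ≤
      Torus.symb (Sideband.psiStar cubatureWord MB MB_pos ν S) k p := by
  have hwin := symb_psiStar_ge_of_residue_window ha hres hlo hlh h1 h2 hβ0 hβ hlam hN hO hν k p hkp
  have hg := gainForm_cubatureWord_ge (M := MB) (x := 11 / 10) (by norm_num [MB]) (by norm_num) k p hkp
  have hρ : 0 ≤ 1 - ρB := by norm_num [ρB]
  have hstep : (1 - ρB) * (97 / 100) * (3 / 10 * c0) / (11 / 10) * ((∑ a, k a ^ 2) * (∑ i, p i ^ 2)) ≤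
      (1 - ρB) * (97 / 100 * (gainForm cubatureWord MB (11 / 10) k p / (11 / 10))) := by
    have e : (1 - ρB) * (97 / 100) * (3 / 10 * c0) / (11 / 10) * ((∑ a, k a ^ 2) * (∑ i, p i ^ 2)) =
        (1 - ρB) * (97 / 100 * ((3 / 10 * c0 * (∑ i, k i ^ 2) * (∑ i, p i ^ 2)) / (11 / 10))) := by ring
    rw [e]
    exact mul_le_mul_of_nonneg_left (mul_le_mul_of_nonneg_left (div_le_div_of_nonneg_right hg (by norm_num)) (by norm_num)) hρ
  exact hstep.trans hwin

/-- **`hcoer`** for the cubature word at width `B₁`: with `lo_eff = (1/n²)(ν·(lo/λ) + cψ/ν)` and `r₁ = 4π²·lo_eff·|ℓ|²`,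
`4π²·lo_eff·|ℓ|²·‖v‖² ≤ ⟪effGenC ((1/n²)•(ν•S + (1/ν)•Ψ⋆_ν(S))) ℓ r₁ v, v⟫_ℝ`. [cite: MajdaKramer1999, §2.2.1.3 (55)] -/
theorem effGenC_effTensor_coercive {a : ℝ} (ha : 0 < a)
    (hres : ∀ ν ∈ Set.Ioc 0 νB₁, ∀ S : T4, Torus.NearIso S (10 / 11) (11 / 10) → ∀ τ ∈ Set.Icc (0:ℝ) (1 / 20), OddSectorial S τ →
      RelSmall (ΨB₁ a ν S - ΦB a S) (ΦB a S) ρB)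
    {lo hi ΛV β lam : ℝ} (hlo : 0 < lo) (hlh : lo ≤ hi) (h1 : hi * ΛV ≤ 11 / 10) (h2 : 10 / 11 * ΛV ≤ lo) (hβ0 : 0 ≤ β)
    (hβ : β * ΛV ≤ lo / 20) (hlam : lam ∈ Set.Icc 1 ΛV) {S : T4} (hN : Torus.NearIso S (lo / lam) (hi * lam)) (hO : Torus.OddSmall S β)
    {ν : ℝ} (hν : ν ∈ Set.Ioc 0 νB₁) (n : ℕ) (ℓ : Fin 3 → ℤ) (v : EuclideanSpace ℂ (Fin 3)) :
    4 * Real.pi ^ 2 * (1 / (n : ℝ) ^ 2 * (ν * (lo / lam) + (1 - ρB) * (97 / 100) * (3 / 10 * c0) / (11 / 10) / ν)) * freqNormSq ℓ * ‖v‖ ^ 2 ≤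
      ⟪effGenC ((1 / (n : ℝ) ^ 2) • (ν • S + (1 / ν) • Sideband.psiStar cubatureWord MB MB_pos ν S)) ℓ
          (4 * Real.pi ^ 2 * (1 / (n : ℝ) ^ 2 * (ν * (lo / lam) + (1 - ρB) * (97 / 100) * (3 / 10 * c0) / (11 / 10) / ν)) * freqNormSq ℓ) v,
        v⟫_ℝ := by
  have hlam1 : 1 ≤ lam := hlam.1
  have hlam0 : 0 < lam := by linarith
  have hνS : Torus.NearIso (ν • S) (ν * (lo / lam)) (ν * (hi * lam)) := hN.smul hν.1.le
  have hA : ∀ k p : Fin 3 → ℝ, ∑ i, p i * k i = 0 → ν * (lo / lam) * ((∑ a, k a ^ 2) * (∑ i, p i ^ 2)) ≤ Torus.symb (ν • S) k p :=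
    fun k p hkp => (hνS k p hkp).1
  have hΨ : ∀ k p : Fin 3 → ℝ, ∑ i, p i * k i = 0 →
      (1 - ρB) * (97 / 100) * (3 / 10 * c0) / (11 / 10) * ((∑ a, k a ^ 2) * (∑ i, p i ^ 2)) ≤
        Torus.symb (Sideband.psiStar cubatureWord MB MB_pos ν S) k p :=
    fun k p hkp => symb_psiStar_ge_cψ ha hres hlo hlh h1 h2 hβ0 hβ hlam hN hO hν k p hkp
  have hlow := symb_effTensor_ge hν.1 n hA hΨ
  have hc0 : 0 ≤ c0 := by rw [c0]; positivity
  have hρ : 0 ≤ 1 - ρB := by norm_num [ρB]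
  have hlo' : 0 ≤ 1 / (n : ℝ) ^ 2 * (ν * (lo / lam) + (1 - ρB) * (97 / 100) * (3 / 10 * c0) / (11 / 10) / ν) := by
    have := hν.1; positivity
  exact effGenC_coercive_of_lower hlow hlo' ℓ v

end Summit.AnomalousDissipation.AnomalousDissipation.Theorems.SolenoidalFractalHomogenisation.LagrangianStep.Sideband

end
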